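import Summits.ResolutionOfSingularities.ResolutionOfSingularities.Theorems.HomologicalConductorNoZenoExcDegreeNonzero
import Literature.AlgebraicGeometry.Resolution.ExceptionalCurveDegree
import HarnessLib

/-!
# Crux `NoZenoR` (stmt-ResolutionOfSingularities-19943), slot `stub_L1wCoreF`, (B1) split core upstairs:
# intersection numbers vanish off the support, are `≤ 0` where `𝒪_X(-D)` is generated, and the set
# `P = {E : (Z·E) < 0}` is non-empty

Route `ResolutionOfSingularities/HomologicalConductor`.  OURS (cell res-hironaka, crux chain W4.4, lead seat
res-L0-w44-lead-1 g8); nothing here is a statement of the manuscript under review (Hironaka 2017); AI-written,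
weaker than expert review.  Helper for the registered stub `stub_L1wCoreF` (crux skeleton v32 b474ebe3723ba67f, HOME
`L/res-L0-w44-lead-1/NoZeno-v32.lean`): the SIGN half of STEP 3 (1) of the (B1) split core (res-L0-w44-stub-2
(L1)-PREP v2 §2; lead memo `B1-CENSUS-g8.md`), complementing `…NoZenoExcDegreeNonzero` (UP-1′).

For `π : X → Spec T` (`T` local), `D` a Cartier divisor on the integral, locally Noetherian `X`, `η ∈ excCurvePoints π`:

* `excCurveDegree_eq_zero_of_forall_avoids` — if `D` avoids every specialisation of `η` (i.e. every point of the
  curve `E_η = closure {η}` lies off `Supp D`) then `(𝒪_X(D) · E_η) = 0`; `LinEquiv` form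
  `excCurveDegree_eq_zero_of_linEquiv_of_forall_avoids` (the shape in which the (B1) assembly uses it: on the chart
  `V` where `I·𝒪 = x·𝒪`, `Z ∼ Z − div(x)` and `Z − div(x)` avoids `V ⊇ E_η`, so the curves contracted to the chart
  germ are `Z`-trivial — the only direction of PREP's UP-3 that is consumed);
* `excCurveDegree_nonneg_of_isSection` — if `𝒪_X(D)` has a global section `s` generating it at `η`
  (`η ∈ D.nonvanishing s`) then `(𝒪_X(D) · E_η) ≥ 0` (generalises the tree's `excCurveDegree_nonneg_of_isEffective`,
  the case `s = 1`); hence `excCurveDegree_nonpos_of_isSection_neg`: if `𝒪_X(-D)` is generated at `η` by a global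
  section then `(𝒪_X(D) · E_η) ≤ 0` — ANTI-NEFNESS of the cycle `Z` with `𝒪(−Z) = I·𝒪_(X¹)` at every curve on whose
  generic stalk some element of `I` generates;
* `exists_excCurveDegree_neg_of_forall_isSection_neg` — **STEP 3 (1) packaged**: for a resolution of a
  two-dimensional normal local domain with `H¹ = 0`, an effective `D ≠ 0` supported on the closed fibre with
  `𝒪_X(-D)` generated at every exceptional generic point has `(D·E_η) < 0` for some `η` (UP-1′
  `exists_excCurveDegree_neg_of_supp_of_ringKrullDim_eq_two` + the sign lemma; conditional on `Lipman1969_12_1_i`).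

References: J. Lipman, *Rational singularities …*, Publ. Math. IHÉS 36 (1969), §12 Remark 2 c) (p. 221), Thm. (12.1)
(i) (p. 220) [`Lipman1969`]; res-L0-w44-stub-2 (L1)-PREP v2 §2 (OURS, 2026-08-27).
-/

noncomputable section

-- single-problem summit: the doubled namespace component `ResolutionOfSingularities` is forced
set_option linter.dupNamespace false

namespace Summit.ResolutionOfSingularities.ResolutionOfSingularities.Theorems.NoZeno.ExcCount

open CategoryTheory AlgebraicGeometry TopologicalSpace IsLocalRing
open Literature.AlgebraicGeometry.Resolution Literature.AlgebraicGeometry.Motives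
open Literature.AlgebraicGeometry.Motives.RatFn

universe u

section Avoids

variable {T : Type u} [CommRing T] [IsLocalRing T] {X : Scheme.{u}} [IsIntegral X] [IsLocallyNoetherian X]
  (π : X ⟶ Spec (.of T))

omit [IsLocalRing T] in
/-- **Off the support the intersection number vanishes**: if `D` avoids every point of the curve
`E_η = closure {η}` (every specialisation of `η`), then `(𝒪_X(D) · E_η) = 0` — each local order
`ord_y(D|_(E_η))` is zero. [cite: Lipman1969, Section 12, Remark 2 c) (p. 221)] -/
theorem excCurveDegree_eq_zero_of_forall_avoids (D : CartierDivisor X) {η : X}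
    (h : ∀ y : X, η ⤳ y → D.Avoids y) : excCurveDegree π D η = 0 := by
  unfold excCurveDegree
  refine finsum_eq_zero_of_forall_eq_zero fun y => ?_
  have hy : η ⤳ (ClosedSubvariety.ofPoint X η).ι y :=
    specializes_iff_mem_closure.mpr
      ((ClosedSubvariety.range_ofPoint_ι (X := X) η).le ⟨y, rfl⟩)
  rw [(CartierDivisor.Avoids.pullbackRep (g := (ClosedSubvariety.ofPoint X η).ι) (h _ hy)).ordAt_eq_zero,
    zero_mul]

variable [IsProper π]

/-- **`LinEquiv` form**: if `D ∼ D₀` and `D₀` avoids every point of `E_η` (`η` an integral exceptional curve), then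
`(𝒪_X(D) · E_η) = 0`.  (In the (B1) assembly: `D = Z`, `D₀ = Z − div(x)` on the chart where `x` generates
`I·𝒪 = 𝒪(−Z)`.) [cite: Lipman1969, Section 12, Remark 2 b)–c) (p. 221)] -/
theorem excCurveDegree_eq_zero_of_linEquiv_of_forall_avoids {η : X} (hη : η ∈ excCurvePoints π)
    {D D₀ : CartierDivisor X} (H : D.LinEquiv D₀) (h : ∀ y : X, η ⤳ y → D₀.Avoids y) :
    excCurveDegree π D η = 0 := by
  rw [excCurveDegree_congr_linEquiv π hη H]
  exact excCurveDegree_eq_zero_of_forall_avoids π D₀ h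

/-- **A divisor generated at `η` by a global section meets `E_η` non-negatively**: if `s ∈ Γ(X, 𝒪_X(D))`
generates `𝒪_X(D)` at `η` (`η ∈ X_s`), then `(𝒪_X(D) · E_η) ≥ 0` — `D + div(s)` is effective and avoids `η`
(generalises `excCurveDegree_nonneg_of_isEffective`, the case `s = 1`). [cite: Lipman1969, Section 12, Remark 2 c) (p. 221)] -/
theorem excCurveDegree_nonneg_of_isSection {η : X} (hη : η ∈ excCurvePoints π) (D : CartierDivisor X)
    {s : X.functionField} (hs : D.IsSection s) (hηs : η ∈ D.nonvanishing s) :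
    0 ≤ excCurveDegree π D η := by
  obtain ⟨i, hi, hu⟩ := hηs
  have hs0 : s ≠ 0 := by
    intro h0
    have := hu.ne_zero
    rw [h0, mul_zero] at this
    exact this rfl
  have heff : (D + CartierDivisor.principal s hs0).IsEffective :=
    (CartierDivisor.isEffective_add_principal_iff (D := D) hs0).mpr hs
  have hav : (D + CartierDivisor.principal s hs0).Avoids η :=
    CartierDivisor.Avoids.of_mem (D := D + CartierDivisor.principal s hs0) (i := (i, PUnit.unit))
      ⟨hi, trivial⟩ hu
  have h1 := excCurveDegree_nonneg_of_isEffective π hη heff hav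
  rw [excCurveDegree_add π hη, excCurveDegree_principal π hη hs0, add_zero] at h1
  exact h1

/-- **Anti-nefness from generation of `𝒪_X(-D)`**: if `𝒪_X(-D)` has a global section generating it at `η`, then
`(𝒪_X(D) · E_η) ≤ 0`.  (For the cycle `Z ≥ 0` with `I·𝒪_(X¹) = 𝒪(−Z)`: every element of `I` is a global section of
`𝒪(−Z)`, and at each `η` one of them generates — so `Z` is anti-nef.) [cite: Lipman1969, Section 12, Remark 2 c) (p. 221)] -/
theorem excCurveDegree_nonpos_of_isSection_neg {η : X} (hη : η ∈ excCurvePoints π) (D : CartierDivisor X)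
    {s : X.functionField} (hs : (-D).IsSection s) (hηs : η ∈ (-D).nonvanishing s) :
    excCurveDegree π D η ≤ 0 := by
  have h := excCurveDegree_nonneg_of_isSection π hη (-D) hs hηs
  rw [excCurveDegree_neg π hη] at h
  omega

end Avoids

/-! ## STEP 3 (1) packaged: `P = {E : (Z·E) < 0} ≠ ∅` -/

section Packaged

variable {T : Type u} [CommRing T] [IsDomain T] [IsNoetherianRing T] [IsLocalRing T] [IsIntegrallyClosed T]
  {X : Scheme.{u}} [IsIntegral X] [IsLocallyNoetherian X] {π : X ⟶ Spec (.of T)}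

/-- **`P ≠ ∅` for an anti-nef exceptional cycle** (STEP 3 (1) of the (B1) split core).  For a resolution
`π : X → Spec T` of a two-dimensional normal local domain with `H¹(X, 𝒪_X) = 0`, and an effective Cartier divisor
`D` supported on the closed fibre and non-zero (`Supp D ≠ ∅`) such that `𝒪_X(-D)` is generated at every integral
exceptional curve by a global section: granting Lipman (12.1) (i), `(𝒪_X(D) · E_η) < 0` for some `η`.
[cite: Lipman1969, Theorem (12.1) (i) (p. 220) and Section 12, Remark 2 c) (p. 221)] -/
theorem exists_excCurveDegree_neg_of_forall_isSection_neg (h121 : Lipman1969_12_1_i.{u})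
    (hdim : ringKrullDim T = 2) (hπ : IsResolution π) (hH1 : HasTrivialCechH1 π)
    (D : CartierDivisor X) (hD : D.IsEffective)
    (hoff : ∀ x : X, π.base x ≠ closedPoint T → D.Avoids x) (hx₀ : ∃ x₀ : X, ¬ D.Avoids x₀)
    (hgen : ∀ η ∈ excCurvePoints π, ∃ s : X.functionField, (-D).IsSection s ∧ η ∈ (-D).nonvanishing s) :
    ∃ η ∈ excCurvePoints π, excCurveDegree π D η < 0 := by
  haveI : IsProper π := hπ.isProper
  refine exists_excCurveDegree_neg_of_supp_of_ringKrullDim_eq_two h121 hdim hπ hH1 D hD hoff hx₀ ?_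
  intro η hη
  obtain ⟨s, hs, hηs⟩ := hgen η hη
  exact excCurveDegree_nonpos_of_isSection_neg π hη D hs hηs

end Packaged

end Summit.ResolutionOfSingularities.ResolutionOfSingularities.Theorems.NoZeno.ExcCount

end
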